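import Literature.NumberTheory.EllipticCurves.ManinConstantAdditivePrimesProofs
import HarnessLib

/-!
# Kraus-type non-minimality at `2` and `3`: `2⁸ ∣ c₄ ∧ 2¹¹ ∣ c₆` and `3⁵ ∣ c₄ ∧ 3⁹ ∣ c₆` are
# impossible for a minimal equation (proofs only)

Topic `NumberTheory/EllipticCurves` (theorems only; no definition, no named fact). The `p = 2, 3`
counterparts of `WeierstrassCurve.not_pow_dvd_of_isMinimal` (`AdditiveReductionSemistableModelProofs`,
`p ≥ 5`: a minimal equation forbids `p⁴ ∣ A ∧ p⁶ ∣ B` on its short model). At `p = 2, 3` the short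
model is not `p`-integral in general, so the statement is made on `c₄, c₆` of the equation itself:

* `not_pow_dvd_c₄_c₆_of_isMinimal_two`: a `ℤ₂`-minimal equation over `ℚ₂` never has
  `2⁸ ∣ c₄ ∧ 2¹¹ ∣ c₆`. Construction: the equation `y² = x³ − (c₄/768)x − c₆/55296`
  (`768 = 3·2⁸`, `55296 = 27·2¹¹`), i.e. the scaling `u = 2` of Mathlib's short normal form
  `y² = x³ − (c₄/48)x − c₆/864`, is then `2`-integral and `ℚ₂`-isomorphic to the given one with
  `Δ/2¹²` — the constructive instance `16 ∣ c₄, c₆ ≡ 0 (32)` of Kraus's integrality criterion at `2`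
  (Kraus 1989, Prop. 2: `(c₄, c₆)` come from an integral equation iff `c₆ ≡ −1 (mod 4)` or
  `16 ∣ c₄ ∧ c₆ ≡ 0, 8 (mod 32)`, applied to `(c₄/2⁴, c₆/2⁶)`).
* `not_pow_dvd_c₄_c₆_of_isMinimal_three`: a `ℤ₃`-minimal equation over `ℚ₃` never has
  `3⁵ ∣ c₄ ∧ 3⁹ ∣ c₆` (`y² = x³ − (c₄/3888)x − c₆/629856`, `3888 = 2⁴3⁵`, `629856 = 2⁵3⁹`; Kraus's
  criterion at `3` is `v₃(c₆) ≠ 2`, applied to `(c₄/3⁴, c₆/3⁶)`).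
* `not_pow_dvd_c₄_Δ_of_isMinimal_two`/`_three`: hence `2⁸ ∣ c₄ ∧ 2¹⁶ ∣ Δ` and
  `3⁵ ∣ c₄ ∧ 3¹⁴ ∣ Δ` are impossible for a minimal equation (`c₆² = c₄³ − 1728Δ`). In the
  finite-height route to `Literature.NumberTheory.EllipticCurves.edixhoven_int_of_neronLattice_eq_smul_periodLattice`
  (`NeronIsogenyScaling.lean`, "A finite-height refinement") these bound the twist exponent `ν` of a
  semistable twist at an additive `p ∈ {2, 3}` (`12ν = min(v(Δ_min), 3v(c₄))`): `12ν ≤ 23` at `2`,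
  with `v₂(c₄) ≤ 7` whenever `12ν ≥ 16`, and `12ν ≤ 13` at `3` — which is what makes the additive
  primes `2, 3` of that fact decidable by the sharp (Newton-polygon) form of the local lemma.

## References

* A. Kraus, *Quelques remarques à propos des invariants `c₄`, `c₆` et `Δ` d'une courbe
  elliptique*, Acta Arith. 54 (1989), 75–80, Prop. 2. [folklore]
* J. H. Silverman, *The Arithmetic of Elliptic Curves*, 2nd ed. (2009), III.1 (short Weierstrass
  form, `c₄ = −48a₄`, `c₆ = −864a₆`), VII.1 Remark 1.1. [SilvermanAEC2009]
-/

noncomputable section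

open scoped Classical

namespace WeierstrassCurve

variable {p : ℕ} [hp : Fact p.Prime]

/-! ### The core: no integral twist by `u = p` of a minimal equation -/

/-- **No `ℤ_p`-integral rescaling by `u = p` of a `ℤ_p`-minimal equation** (the definition of
minimality read through `Padic.mulValuation`: the discriminant would drop by `p¹²`).
[cite: SilvermanAEC2009, VII.1 Remark 1.1] -/
theorem not_isIntegral_smul_of_isMinimal_of_u_eq (X : WeierstrassCurve ℚ_[p])
    [hX : X.IsMinimal ℤ_[p]] (hΔ : X.Δ ≠ 0) (C : VariableChange ℚ_[p]) (hCu : (C.u : ℚ_[p]) = p) :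
    ¬ (C • X).IsIntegral ℤ_[p] := by
  intro hint
  have hp0 : (p : ℚ_[p]) ≠ 0 := by exact_mod_cast hp.out.ne_zero
  have hle : Padic.mulValuation (C • X).Δ ≤ Padic.mulValuation X.Δ :=
    ((isMinimal_iff_of_le_one_iff (padicMulValuation_le_one_iff (p := p)) X).mp hX).2 C hint
  have hΔC : (C • X).Δ = (p : ℚ_[p])⁻¹ ^ 12 * X.Δ := by
    rw [variableChange_Δ, Units.val_inv_eq_inv_val, hCu]
  have hΔC0 : (C • X).Δ ≠ 0 := by
    rw [hΔC]; exact mul_ne_zero (pow_ne_zero _ (inv_ne_zero hp0)) hΔ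
  rw [padicMulValuation_apply_of_ne_zero hΔC0, padicMulValuation_apply_of_ne_zero hΔ,
    WithZero.exp_le_exp, neg_le_neg_iff, hΔC,
    Padic.valuation_mul (pow_ne_zero _ (inv_ne_zero hp0)) hΔ, Padic.valuation_pow,
    Padic.valuation_inv, Padic.valuation_p] at hle
  norm_num at hle

/-- The short normal form of `X` over `ℚ_p` is `y² = x³ − (c₄/48)x − c₆/864` (Mathlib's `toShortNF`
has `u = 1`, so `c₄, c₆` are unchanged, and `c₄ = −48a₄`, `c₆ = −864a₆` on a short form).
[cite: SilvermanAEC2009, III.1 (short Weierstrass form)] -/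
theorem toShortNF_smul_eq_of_c₄_c₆ (X : WeierstrassCurve ℚ_[p]) :
    letI : Invertible (2 : ℚ_[p]) := invertibleOfNonzero two_ne_zero
    letI : Invertible (3 : ℚ_[p]) := invertibleOfNonzero three_ne_zero
    X.toShortNF • X =
      { a₁ := 0, a₂ := 0, a₃ := 0, a₄ := -X.c₄ / 48, a₆ := -X.c₆ / 864 } := by
  letI : Invertible (2 : ℚ_[p]) := invertibleOfNonzero two_ne_zero
  letI : Invertible (3 : ℚ_[p]) := invertibleOfNonzero three_ne_zero
  have hTu : X.toShortNF.u = 1 := by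
    rw [WeierstrassCurve.toShortNF, VariableChange.mul_def]
    simp [WeierstrassCurve.toCharNeTwoNF]
  haveI hSh : (X.toShortNF • X).IsShortNF := X.toShortNF_spec
  have h4 : (X.toShortNF • X).c₄ = X.c₄ := by rw [variableChange_c₄, hTu]; simp
  have h6 : (X.toShortNF • X).c₆ = X.c₆ := by rw [variableChange_c₆, hTu]; simp
  have ha₄ : (X.toShortNF • X).a₄ = -X.c₄ / 48 := by
    have := (X.toShortNF • X).c₄_of_isShortNF
    rw [h4] at this
    rw [this]; ring
  have ha₆ : (X.toShortNF • X).a₆ = -X.c₆ / 864 := by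
    have := (X.toShortNF • X).c₆_of_isShortNF
    rw [h6] at this
    rw [this]; ring
  ext
  · exact hSh.a₁
  · exact hSh.a₂
  · exact hSh.a₃
  · exact ha₄
  · exact ha₆

/-- The scaling `(u, 0, 0, 0)` of a short equation, coefficientwise (Silverman III.1 Table 3.1 with
`r = s = t = 0`). [cite: SilvermanAEC2009, III.1 Table 3.1 (PDF p. 50)] -/
theorem scale_smul_short (u : ℚ_[p]ˣ) (a₄ a₆ : ℚ_[p]) :
    (⟨u, 0, 0, 0⟩ : VariableChange ℚ_[p]) •
        ({ a₁ := 0, a₂ := 0, a₃ := 0, a₄ := a₄, a₆ := a₆ } : WeierstrassCurve ℚ_[p]) =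
      { a₁ := 0, a₂ := 0, a₃ := 0, a₄ := (u : ℚ_[p])⁻¹ ^ 4 * a₄, a₆ := (u : ℚ_[p])⁻¹ ^ 6 * a₆ } := by
  rw [variableChange_def]
  ext <;> simp

/-- A `p`-adic number of norm `≤ 1` lifts to `ℤ_p` (the form consumed by
`WeierstrassCurve.isIntegral_of_exists_lift`). [folklore] -/
theorem exists_padicInt_algebraMap_eq {x : ℚ_[p]} (hx : ‖x‖ ≤ 1) :
    ∃ r : ℤ_[p], algebraMap ℤ_[p] ℚ_[p] r = x :=
  ⟨⟨x, hx⟩, rfl⟩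

/-! ### `p = 2` -/

/-- **Kraus at `2`, constructive case: a `ℤ₂`-minimal equation never has `2⁸ ∣ c₄` and `2¹¹ ∣ c₆`.**
If `c₄ = 2⁸A`, `c₆ = 2¹¹B` with `A, B ∈ ℤ₂`, the equation `y² = x³ − (A/3)x − B/27` — the scaling
`u = 2` of the short normal form `y² = x³ − (c₄/48)x − c₆/864` — is `ℤ₂`-integral (`3 ∈ ℤ₂ˣ`) and
`ℚ₂`-isomorphic to `X` with discriminant `Δ/2¹²`, contradicting minimality. (Kraus 1989, Prop. 2:
`(c₄/2⁴, c₆/2⁶)` satisfies `16 ∣ c₄'`, `c₆' ≡ 0 (mod 32)`.) [cite: SilvermanAEC2009, VII.1 Remark 1.1] -/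
theorem not_pow_dvd_c₄_c₆_of_isMinimal_two (X : WeierstrassCurve ℚ_[2]) [X.IsMinimal ℤ_[2]]
    (hΔ : X.Δ ≠ 0) {c₄ c₆ : ℤ_[2]} (h₄ : X.c₄ = c₄) (h₆ : X.c₆ = c₆) :
    ¬ ((2 : ℤ_[2]) ^ 8 ∣ c₄ ∧ (2 : ℤ_[2]) ^ 11 ∣ c₆) := by
  rintro ⟨⟨A, hA⟩, ⟨B, hB⟩⟩
  letI : Invertible (2 : ℚ_[2]) := invertibleOfNonzero two_ne_zero
  letI : Invertible (3 : ℚ_[2]) := invertibleOfNonzero three_ne_zero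
  have h20 : (2 : ℚ_[2]) ≠ 0 := two_ne_zero
  set π : ℚ_[2]ˣ := Units.mk0 (2 : ℚ_[2]) h20 with hπ
  set C : VariableChange ℚ_[2] := ⟨π, 0, 0, 0⟩ * X.toShortNF with hC
  have hTu : X.toShortNF.u = 1 := by
    rw [WeierstrassCurve.toShortNF, VariableChange.mul_def]
    simp [WeierstrassCurve.toCharNeTwoNF]
  have hCu : (C.u : ℚ_[2]) = (2 : ℕ) := by
    rw [hC, VariableChange.mul_def]
    simp [hπ, hTu]
  have e2 : ((2 : ℤ_[2]) : ℚ_[2]) = 2 := rfl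
  have hc₄ : X.c₄ = 2 ^ 8 * (A : ℚ_[2]) := by
    rw [h₄, hA, PadicInt.coe_mul, PadicInt.coe_pow, e2]
  have hc₆ : X.c₆ = 2 ^ 11 * (B : ℚ_[2]) := by
    rw [h₆, hB, PadicInt.coe_mul, PadicInt.coe_pow, e2]
  have hCX : C • X = { a₁ := 0, a₂ := 0, a₃ := 0, a₄ := -(A : ℚ_[2]) / 3, a₆ := -(B : ℚ_[2]) / 27 } := by
    rw [hC, mul_smul, X.toShortNF_smul_eq_of_c₄_c₆, scale_smul_short, hc₄, hc₆]
    congr 1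
    · rw [hπ, Units.val_mk0]; field_simp; ring
    · rw [hπ, Units.val_mk0]; field_simp; ring
  have h3 : ‖(3 : ℚ_[2])‖ = 1 := by
    rw [show (3 : ℚ_[2]) = ((3 : ℕ) : ℚ_[2]) by norm_num, Padic.norm_natCast_eq_one_iff]; decide
  have h27 : ‖(27 : ℚ_[2])‖ = 1 := by
    rw [show (27 : ℚ_[2]) = ((27 : ℕ) : ℚ_[2]) by norm_num, Padic.norm_natCast_eq_one_iff]; decide
  have n₄ : ‖-(A : ℚ_[2]) / 3‖ ≤ 1 := by
    rw [norm_div, norm_neg, h3, div_one]; exact A.2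
  have n₆ : ‖-(B : ℚ_[2]) / 27‖ ≤ 1 := by
    rw [norm_div, norm_neg, h27, div_one]; exact B.2
  have hint : (C • X).IsIntegral ℤ_[2] := by
    rw [hCX]
    exact isIntegral_of_exists_lift _ ⟨0, by simp⟩ ⟨0, by simp⟩ ⟨0, by simp⟩
      (exists_padicInt_algebraMap_eq n₄) (exists_padicInt_algebraMap_eq n₆)
  exact not_isIntegral_smul_of_isMinimal_of_u_eq X hΔ C hCu hint

/-- **At `2`: `2⁸ ∣ c₄ ∧ 2¹⁶ ∣ Δ` is impossible for a `ℤ₂`-minimal equation** — then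
`c₆² = c₄³ − 1728Δ` is divisible by `2²²`, so `2¹¹ ∣ c₆`, and `not_pow_dvd_c₄_c₆_of_isMinimal_two`
applies. (So a minimal equation with `v₂(Δ) ≥ 16` has `v₂(c₄) ≤ 7`, and one with `v₂(j) ≥ 0` has
`v₂(Δ) ≤ 23`.) [cite: SilvermanAEC2009, VII.1 Remark 1.1] -/
theorem not_pow_dvd_c₄_Δ_of_isMinimal_two (X : WeierstrassCurve ℚ_[2]) [X.IsMinimal ℤ_[2]]
    (hΔ : X.Δ ≠ 0) {c₄ c₆ Δ : ℤ_[2]} (h₄ : X.c₄ = c₄) (h₆ : X.c₆ = c₆) (hΔ' : X.Δ = Δ) :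
    ¬ ((2 : ℤ_[2]) ^ 8 ∣ c₄ ∧ (2 : ℤ_[2]) ^ 16 ∣ Δ) := by
  rintro ⟨⟨A, hA⟩, ⟨D, hD⟩⟩
  refine not_pow_dvd_c₄_c₆_of_isMinimal_two X hΔ h₄ h₆ ⟨⟨A, hA⟩, ?_⟩
  -- `c₆² = c₄³ − 1728 Δ = 2²² (4A³ − 27D)` in `ℤ₂`
  have hrel : c₆ ^ 2 = (2 : ℤ_[2]) ^ 22 * (4 * A ^ 3 - 27 * D) := by
    have h := X.c_relation
    rw [h₄, h₆, hΔ'] at h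
    rw [show (1728 : ℚ_[2]) = (((1728 : ℕ) : ℤ_[2]) : ℚ_[2]) by
      rw [PadicInt.coe_natCast]; norm_num] at h
    have h' : ((1728 : ℕ) : ℤ_[2]) * Δ = c₄ ^ 3 - c₆ ^ 2 := PadicInt.ext (by exact_mod_cast h)
    rw [Nat.cast_ofNat, hA, hD] at h'
    linear_combination h'
  rcases eq_or_ne c₆ 0 with h0 | h0
  · rw [h0]; exact dvd_zero _
  have h2 : (2 : ℤ_[2]) = ((2 : ℕ) : ℤ_[2]) := by norm_num
  have hv : 22 ≤ (c₆ ^ 2).valuation := by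
    have hne : (4 * A ^ 3 - 27 * D : ℤ_[2]) ≠ 0 := by
      intro hz; apply h0; rw [hz, mul_zero] at hrel; exact pow_eq_zero_iff (n := 2) (by norm_num) |>.mp hrel
    rw [hrel, h2, PadicInt.valuation_p_pow_mul _ _ hne]
    exact Nat.le_add_right _ _
  rw [PadicInt.valuation_pow] at hv
  rw [h2]
  exact (Literature.NumberTheory.EllipticCurves.padicInt_pow_dvd_iff_le_valuation h0 11).mpr
    (by omega)

/-! ### `p = 3` -/

/-- **Kraus at `3`, constructive case: a `ℤ₃`-minimal equation never has `3⁵ ∣ c₄` and `3⁹ ∣ c₆`.**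
If `c₄ = 3⁵A`, `c₆ = 3⁹B`, the equation `y² = x³ − (A/16)x − B/32` — the scaling `u = 3` of the
short normal form — is `ℤ₃`-integral and `ℚ₃`-isomorphic to `X` with discriminant `Δ/3¹²`.
(Kraus 1989, Prop. 2 at `3`: `v₃(c₆/3⁶) ≥ 3 ≠ 2`.) [cite: SilvermanAEC2009, VII.1 Remark 1.1] -/
theorem not_pow_dvd_c₄_c₆_of_isMinimal_three (X : WeierstrassCurve ℚ_[3]) [X.IsMinimal ℤ_[3]]
    (hΔ : X.Δ ≠ 0) {c₄ c₆ : ℤ_[3]} (h₄ : X.c₄ = c₄) (h₆ : X.c₆ = c₆) :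
    ¬ ((3 : ℤ_[3]) ^ 5 ∣ c₄ ∧ (3 : ℤ_[3]) ^ 9 ∣ c₆) := by
  rintro ⟨⟨A, hA⟩, ⟨B, hB⟩⟩
  letI : Invertible (2 : ℚ_[3]) := invertibleOfNonzero two_ne_zero
  letI : Invertible (3 : ℚ_[3]) := invertibleOfNonzero three_ne_zero
  have h30 : (3 : ℚ_[3]) ≠ 0 := three_ne_zero
  set π : ℚ_[3]ˣ := Units.mk0 (3 : ℚ_[3]) h30 with hπ
  set C : VariableChange ℚ_[3] := ⟨π, 0, 0, 0⟩ * X.toShortNF with hC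
  have hTu : X.toShortNF.u = 1 := by
    rw [WeierstrassCurve.toShortNF, VariableChange.mul_def]
    simp [WeierstrassCurve.toCharNeTwoNF]
  have hCu : (C.u : ℚ_[3]) = (3 : ℕ) := by
    rw [hC, VariableChange.mul_def]
    simp [hπ, hTu]
  have e3 : ((3 : ℤ_[3]) : ℚ_[3]) = 3 := rfl
  have hc₄ : X.c₄ = 3 ^ 5 * (A : ℚ_[3]) := by
    rw [h₄, hA, PadicInt.coe_mul, PadicInt.coe_pow, e3]
  have hc₆ : X.c₆ = 3 ^ 9 * (B : ℚ_[3]) := by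
    rw [h₆, hB, PadicInt.coe_mul, PadicInt.coe_pow, e3]
  have hCX : C • X = { a₁ := 0, a₂ := 0, a₃ := 0, a₄ := -(A : ℚ_[3]) / 16, a₆ := -(B : ℚ_[3]) / 32 } := by
    rw [hC, mul_smul, X.toShortNF_smul_eq_of_c₄_c₆, scale_smul_short, hc₄, hc₆]
    congr 1
    · rw [hπ, Units.val_mk0]; field_simp; ring
    · rw [hπ, Units.val_mk0]; field_simp; ring
  have h16 : ‖(16 : ℚ_[3])‖ = 1 := by
    rw [show (16 : ℚ_[3]) = ((16 : ℕ) : ℚ_[3]) by norm_num, Padic.norm_natCast_eq_one_iff]; decide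
  have h32 : ‖(32 : ℚ_[3])‖ = 1 := by
    rw [show (32 : ℚ_[3]) = ((32 : ℕ) : ℚ_[3]) by norm_num, Padic.norm_natCast_eq_one_iff]; decide
  have n₄ : ‖-(A : ℚ_[3]) / 16‖ ≤ 1 := by
    rw [norm_div, norm_neg, h16, div_one]; exact A.2
  have n₆ : ‖-(B : ℚ_[3]) / 32‖ ≤ 1 := by
    rw [norm_div, norm_neg, h32, div_one]; exact B.2
  have hint : (C • X).IsIntegral ℤ_[3] := by
    rw [hCX]
    exact isIntegral_of_exists_lift _ ⟨0, by simp⟩ ⟨0, by simp⟩ ⟨0, by simp⟩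
      (exists_padicInt_algebraMap_eq n₄) (exists_padicInt_algebraMap_eq n₆)
  exact not_isIntegral_smul_of_isMinimal_of_u_eq X hΔ C hCu hint

/-- **At `3`: `3⁵ ∣ c₄ ∧ 3¹⁴ ∣ Δ` is impossible for a `ℤ₃`-minimal equation.** From `c₄ = 3⁵A`,
`Δ = 3¹⁴D`: `c₆² = 3¹⁵(A³ − 576D)`, so `3⁸ ∣ c₆`, `c₆ = 3⁸B`, `3B² = A³ − 576D`, whence `3 ∣ A`,
`A = 3A₁`, `B² = 3(3A₁³ − 64D)`, `3 ∣ B`: so `3⁵ ∣ c₄` and `3⁹ ∣ c₆`, and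
`not_pow_dvd_c₄_c₆_of_isMinimal_three` applies. (So a minimal equation has
`min(v₃(Δ), 3v₃(c₄)) ≤ 13`.) [cite: SilvermanAEC2009, VII.1 Remark 1.1] -/
theorem not_pow_dvd_c₄_Δ_of_isMinimal_three (X : WeierstrassCurve ℚ_[3]) [X.IsMinimal ℤ_[3]]
    (hΔ : X.Δ ≠ 0) {c₄ c₆ Δ : ℤ_[3]} (h₄ : X.c₄ = c₄) (h₆ : X.c₆ = c₆) (hΔ' : X.Δ = Δ) :
    ¬ ((3 : ℤ_[3]) ^ 5 ∣ c₄ ∧ (3 : ℤ_[3]) ^ 14 ∣ Δ) := by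
  rintro ⟨⟨A, hA⟩, ⟨D, hD⟩⟩
  have h3p : Prime (3 : ℤ_[3]) := by
    have := PadicInt.prime_p (p := 3); exact_mod_cast this
  -- `c₆² = 3¹⁵ (A³ − 576 D)`
  have h' : (1728 : ℤ_[3]) * Δ = c₄ ^ 3 - c₆ ^ 2 := by
    have h := X.c_relation
    rw [h₄, h₆, hΔ'] at h
    rw [show (1728 : ℚ_[3]) = (((1728 : ℕ) : ℤ_[3]) : ℚ_[3]) by
      rw [PadicInt.coe_natCast]; norm_num] at h
    have h'' : ((1728 : ℕ) : ℤ_[3]) * Δ = c₄ ^ 3 - c₆ ^ 2 := PadicInt.ext (by exact_mod_cast h)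
    rwa [Nat.cast_ofNat] at h''
  have hrel : c₆ ^ 2 = (3 : ℤ_[3]) ^ 15 * (A ^ 3 - 576 * D) := by
    rw [hA, hD] at h'
    linear_combination h'
  -- `3⁸ ∣ c₆`
  have h8 : (3 : ℤ_[3]) ^ 8 ∣ c₆ := by
    rcases eq_or_ne c₆ 0 with h0 | h0
    · rw [h0]; exact dvd_zero _
    have h3 : (3 : ℤ_[3]) = ((3 : ℕ) : ℤ_[3]) := by norm_num
    have hne : (A ^ 3 - 576 * D : ℤ_[3]) ≠ 0 := by
      intro hz; apply h0; rw [hz, mul_zero] at hrel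
      exact pow_eq_zero_iff (n := 2) (by norm_num) |>.mp hrel
    have hv : 15 ≤ (c₆ ^ 2).valuation := by
      rw [hrel, h3, PadicInt.valuation_p_pow_mul _ _ hne]; exact Nat.le_add_right _ _
    rw [PadicInt.valuation_pow] at hv
    rw [h3]
    exact (Literature.NumberTheory.EllipticCurves.padicInt_pow_dvd_iff_le_valuation h0 8).mpr
      (by omega)
  obtain ⟨B, hB⟩ := h8
  -- `3 B² = A³ − 576 D`, so `3 ∣ A`
  have hB2 : 3 * B ^ 2 = A ^ 3 - 576 * D := by
    have h15 : (3 : ℤ_[3]) ^ 15 ≠ 0 := pow_ne_zero _ h3p.ne_zero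
    apply mul_left_cancel₀ h15
    rw [← hrel, hB]; ring
  have hA3 : (3 : ℤ_[3]) ∣ A := by
    apply h3p.dvd_of_dvd_pow (n := 3)
    exact ⟨B ^ 2 + 192 * D, by linear_combination (-1 : ℤ_[3]) * hB2⟩
  obtain ⟨A₁, hA₁⟩ := hA3
  -- `B² = 3 (3A₁³ − 64 D)`, so `3 ∣ B`
  have hB3 : (3 : ℤ_[3]) ∣ B := by
    apply h3p.dvd_of_dvd_pow (n := 2)
    refine ⟨3 * A₁ ^ 3 - 64 * D, ?_⟩
    have : 3 * B ^ 2 = 3 * (3 * (3 * A₁ ^ 3 - 64 * D)) := by rw [hB2, hA₁]; ring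
    exact mul_left_cancel₀ h3p.ne_zero this
  obtain ⟨B₁, hB₁⟩ := hB3
  refine not_pow_dvd_c₄_c₆_of_isMinimal_three X hΔ h₄ h₆ ⟨⟨A, hA⟩, ⟨B₁, ?_⟩⟩
  rw [hB, hB₁]; ring


/-! ### Global form: a globally minimal equation over `ℚ` -/

section Global

open Literature.NumberTheory.EllipticCurves

variable (W : WeierstrassCurve ℚ) [W.IsElliptic] [W.IsGloballyMinimal]

omit [W.IsElliptic] in
/-- The `p`-adic base change of a globally minimal `W/ℚ` has `c₄, c₆, Δ` equal to the integers
`c₄, c₆, Δ` of its `ℤ`-model, read in `ℤ_p`. [folklore] -/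
theorem map_padic_c₄_c₆_Δ_eq_intCast (p : ℕ) [Fact p.Prime] :
    (W.map (algebraMap ℚ ℚ_[p])).c₄ = (((integralModelInt W).c₄ : ℤ_[p]) : ℚ_[p]) ∧
    (W.map (algebraMap ℚ ℚ_[p])).c₆ = (((integralModelInt W).c₆ : ℤ_[p]) : ℚ_[p]) ∧
    (W.map (algebraMap ℚ ℚ_[p])).Δ = ((minimalDiscriminantInt W : ℤ_[p]) : ℚ_[p]) := by
  have hW : W.map (algebraMap ℚ ℚ_[p]) =
      (integralModelInt W).map ((algebraMap ℚ ℚ_[p]).comp (Int.castRingHom ℚ)) := by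
    conv_lhs => rw [← map_integralModelInt W]
    rw [map_map]
  refine ⟨?_, ?_, ?_⟩
  · rw [hW, map_c₄, PadicInt.coe_intCast, eq_intCast]
  · rw [hW, map_c₆, PadicInt.coe_intCast, eq_intCast]
  · rw [hW, map_Δ, PadicInt.coe_intCast, eq_intCast]; rfl

/-- **Globally minimal over `ℚ`: `2⁸ ∣ c₄ ∧ 2¹⁶ ∣ Δ_min` is impossible** (the `ℤ`-model read in
`ℤ₂`, `not_pow_dvd_c₄_Δ_of_isMinimal_two`). In the finite-height route to Edixhoven's integrality
this gives, at an additive `p = 2`, `12ν = min(v₂(Δ_min), 3v₂(c₄)) ≤ 23` and `v₂(c₄) ≤ 7` once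
`12ν ≥ 16`. [cite: SilvermanAEC2009, VII.1 Remark 1.1] -/
theorem not_pow_dvd_c₄_minimalDiscriminantInt_two :
    ¬ ((2 : ℤ) ^ 8 ∣ (integralModelInt W).c₄ ∧ (2 : ℤ) ^ 16 ∣ minimalDiscriminantInt W) := by
  rintro ⟨h₄, hΔ⟩
  haveI : Fact (Nat.Prime 2) := ⟨Nat.prime_two⟩
  set Wp := W.map (algebraMap ℚ ℚ_[2]) with hWp
  haveI : Wp.IsMinimal ℤ_[2] := isMinimal_map_padic_of_isGloballyMinimal W 2
  obtain ⟨e₄, e₆, eΔ⟩ := W.map_padic_c₄_c₆_Δ_eq_intCast 2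
  have hΔ0 : Wp.Δ ≠ 0 := by
    rw [hWp, map_Δ]; exact (map_ne_zero _).mpr W.isUnit_Δ.ne_zero
  refine not_pow_dvd_c₄_Δ_of_isMinimal_two Wp hΔ0 e₄ e₆ eΔ ⟨?_, ?_⟩
  · have := map_dvd (Int.castRingHom ℤ_[2]) h₄
    rwa [map_pow, eq_intCast, eq_intCast, Int.cast_ofNat] at this
  · have := map_dvd (Int.castRingHom ℤ_[2]) hΔ
    rwa [map_pow, eq_intCast, eq_intCast, Int.cast_ofNat] at this

/-- **Globally minimal over `ℚ`: `2⁸ ∣ c₄ ∧ 2¹¹ ∣ c₆` is impossible** (Kraus at `2`, constructive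
case; `not_pow_dvd_c₄_c₆_of_isMinimal_two`). [cite: SilvermanAEC2009, VII.1 Remark 1.1] -/
theorem not_pow_dvd_c₄_c₆_int_two :
    ¬ ((2 : ℤ) ^ 8 ∣ (integralModelInt W).c₄ ∧ (2 : ℤ) ^ 11 ∣ (integralModelInt W).c₆) := by
  rintro ⟨h₄, h₆⟩
  haveI : Fact (Nat.Prime 2) := ⟨Nat.prime_two⟩
  set Wp := W.map (algebraMap ℚ ℚ_[2]) with hWp
  haveI : Wp.IsMinimal ℤ_[2] := isMinimal_map_padic_of_isGloballyMinimal W 2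
  obtain ⟨e₄, e₆, -⟩ := W.map_padic_c₄_c₆_Δ_eq_intCast 2
  have hΔ0 : Wp.Δ ≠ 0 := by
    rw [hWp, map_Δ]; exact (map_ne_zero _).mpr W.isUnit_Δ.ne_zero
  refine not_pow_dvd_c₄_c₆_of_isMinimal_two Wp hΔ0 e₄ e₆ ⟨?_, ?_⟩
  · have := map_dvd (Int.castRingHom ℤ_[2]) h₄
    rwa [map_pow, eq_intCast, eq_intCast, Int.cast_ofNat] at this
  · have := map_dvd (Int.castRingHom ℤ_[2]) h₆
    rwa [map_pow, eq_intCast, eq_intCast, Int.cast_ofNat] at this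

/-- **Globally minimal over `ℚ`: `3⁵ ∣ c₄ ∧ 3¹⁴ ∣ Δ_min` is impossible** (the `ℤ`-model read in
`ℤ₃`, `not_pow_dvd_c₄_Δ_of_isMinimal_three`): at an additive `p = 3` the twist exponent has
`12ν = min(v₃(Δ_min), 3v₃(c₄)) ≤ 13`. [cite: SilvermanAEC2009, VII.1 Remark 1.1] -/
theorem not_pow_dvd_c₄_minimalDiscriminantInt_three :
    ¬ ((3 : ℤ) ^ 5 ∣ (integralModelInt W).c₄ ∧ (3 : ℤ) ^ 14 ∣ minimalDiscriminantInt W) := by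
  rintro ⟨h₄, hΔ⟩
  haveI : Fact (Nat.Prime 3) := ⟨Nat.prime_three⟩
  set Wp := W.map (algebraMap ℚ ℚ_[3]) with hWp
  haveI : Wp.IsMinimal ℤ_[3] := isMinimal_map_padic_of_isGloballyMinimal W 3
  obtain ⟨e₄, e₆, eΔ⟩ := W.map_padic_c₄_c₆_Δ_eq_intCast 3
  have hΔ0 : Wp.Δ ≠ 0 := by
    rw [hWp, map_Δ]; exact (map_ne_zero _).mpr W.isUnit_Δ.ne_zero
  refine not_pow_dvd_c₄_Δ_of_isMinimal_three Wp hΔ0 e₄ e₆ eΔ ⟨?_, ?_⟩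
  · have := map_dvd (Int.castRingHom ℤ_[3]) h₄
    rwa [map_pow, eq_intCast, eq_intCast, Int.cast_ofNat] at this
  · have := map_dvd (Int.castRingHom ℤ_[3]) hΔ
    rwa [map_pow, eq_intCast, eq_intCast, Int.cast_ofNat] at this

/-- **Globally minimal over `ℚ`: `3⁵ ∣ c₄ ∧ 3⁹ ∣ c₆` is impossible** (Kraus at `3`, constructive
case; `not_pow_dvd_c₄_c₆_of_isMinimal_three`). [cite: SilvermanAEC2009, VII.1 Remark 1.1] -/
theorem not_pow_dvd_c₄_c₆_int_three :
    ¬ ((3 : ℤ) ^ 5 ∣ (integralModelInt W).c₄ ∧ (3 : ℤ) ^ 9 ∣ (integralModelInt W).c₆) := by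
  rintro ⟨h₄, h₆⟩
  haveI : Fact (Nat.Prime 3) := ⟨Nat.prime_three⟩
  set Wp := W.map (algebraMap ℚ ℚ_[3]) with hWp
  haveI : Wp.IsMinimal ℤ_[3] := isMinimal_map_padic_of_isGloballyMinimal W 3
  obtain ⟨e₄, e₆, -⟩ := W.map_padic_c₄_c₆_Δ_eq_intCast 3
  have hΔ0 : Wp.Δ ≠ 0 := by
    rw [hWp, map_Δ]; exact (map_ne_zero _).mpr W.isUnit_Δ.ne_zero
  refine not_pow_dvd_c₄_c₆_of_isMinimal_three Wp hΔ0 e₄ e₆ ⟨?_, ?_⟩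
  · have := map_dvd (Int.castRingHom ℤ_[3]) h₄
    rwa [map_pow, eq_intCast, eq_intCast, Int.cast_ofNat] at this
  · have := map_dvd (Int.castRingHom ℤ_[3]) h₆
    rwa [map_pow, eq_intCast, eq_intCast, Int.cast_ofNat] at this

end Global

end WeierstrassCurve
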